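import Summits.CriticalPhenomena.PercolationContinuityZ3.Theorems.PercNearOneGluingNoHeavyLowerTailAntitheticTwoStageInner
import Summits.CriticalPhenomena.PercolationContinuityZ3.Theorems.PercNearOneGluingNoHeavyLowerTailAntitheticTwoStageFan
import Summits.CriticalPhenomena.PercolationContinuityZ3.Theorems.PercNearOneGluingNoHeavyLowerTailAntitheticDegTwoChange
import HarnessLib

/-!
# `NoHeavyLowerTail` (stmt-CriticalPhenomena-4575) — antithetic cluster pairs: THEOREM 2S, the two-stage theorem WITHOUT (H1) — abstract core
# (HOME/THEOREM-2S.md, prim-hp-2 gen 60)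

Support file (`--supports stmt-CriticalPhenomena-4575`, hull-port prover `prim-hp-2`, gen 60).  No definitions, no named facts, no sorries;
standard axioms.  VERTEX version.  Setting of …AntitheticTwoStageInner: side 2 is an abstract cube `T : Set ι ↦ (X₂ T, Y₂ T)` (`X₂` monotone,
`Y₂` antitone, `Y₂ T = X₂ Tᶜ`), `U = {T : z ∉ Y₂ T}`, `cB = |Set ι|`, `cR = #U`; side 1 is a GRAPH side `E₁ ∋ sy` with clusters
`X₁ ω = openCluster (ω ∩ E₁) s`, `Y₁ ω = openCluster (ωᶜ ∩ E₁) s`; `x` is the bonus vertex.  For odd twisted-monotone `h₁, h₂` put, for a row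
`ω₁` with pair `(P, Q) = (X₁ ω₁, Y₁ ω₁)`,
  `TIrow  = Σ_T      h₁h₂ (P ∪ X₂ T) (Q ∪ Y₂ T ∪ x[z ∈ Y₂ T])`   (rows `y ∉ P`: TERM I),
  `TIIrow = Σ_{T∈U}  h₁h₂ (P ∪ X₂ T ∪ x) (Q ∪ Y₂ T)`             (rows `y ∈ P`: TERM II).
**`Antithetic.TwoStage.mixed_bound`**: if side 2 is R-ASSOCIATED (`hR`, as in `TwoStage.inner_bound`) then
  `0 ≤ Σ_{ω₁} ( (cR/cB)·[y ∉ X₁ ω₁]·TIrow + [y ∈ X₁ ω₁]·TIIrow )`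
— NO nestedness hypothesis on side 1 (THEOREM 2H's (H1) is gone; only `sy ∈ E₁` is used).  Proof (HOME/THEOREM-2S.md §1): the complement
involutions of both sides rewrite the sum over the red-pinned cube `{sy red} = A ⊔ M_b` with row integrands `(cR/cB)·M3 + M4` on `A = {y ∉ Y₁}` and
`M4 + M1` on `M_b`; each row is bounded below by `2cR·𝒦₁𝒦₂(P,Q)` using Harris on the cube `Set ι`, the hypothesis `hR` twice and the chain
`TwoStage.constraint_chain` (a Chebyshev step: the two side-2 laws mixed in a row are stochastically ordered); the piecewise function `𝒦ᵢ` is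
twisted-monotone and super-odd, so `TwoStage.pinned_cube_sum_nonneg` (Harris on `{sy red}`) finishes.  With TERM I ≥ 0 on every graph
(`Antithetic.termOne_nonneg`) and `cR ≤ cB` this gives CHANGE = TI + TII ≥ 0 (…AntitheticTwoStageEdge).
[cite: VandenbergHaggstromKahn2005, §1 p. 6 ("Harris' inequality")]
-/

noncomputable section

namespace Summit.CriticalPhenomena.PercolationContinuityZ3.Theorems

open Literature.Probability.Percolation
open scoped Classical

namespace Antithetic

namespace TwoStage

variable {V : Type*} [Fintype V] {ι : Type*} [Fintype ι]

/-- Chebyshev step of the two-point mixture lemma: `c₁ ≤ a₁`, `c₂ ≤ a₂` ⇒ `(a₁+c₁)(a₂+c₂)/2 ≤ a₁a₂ + c₁c₂`. [folklore] -/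
theorem mix_two {a₁ a₂ c₁ c₂ : ℝ} (h₁ : c₁ ≤ a₁) (h₂ : c₂ ≤ a₂) : (a₁ + c₁) * (a₂ + c₂) / 2 ≤ a₁ * a₂ + c₁ * c₂ := by
  nlinarith [mul_nonneg (sub_nonneg.2 h₁) (sub_nonneg.2 h₂)]

/-- Harris on the cube `Set ι` for monotone real functions of any sign, in the form `(Σ f)(Σ g)/|Set ι| ≤ Σ f g`.
[cite: VandenbergHaggstromKahn2005, §1 p. 6 ("Harris' inequality")] -/
theorem harris_div {f g : Set ι → ℝ} (hf : Monotone f) (hg : Monotone g) :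
    (∑ T, f T) * (∑ T, g T) / (Fintype.card (Set ι) : ℝ) ≤ ∑ T, f T * g T := by
  have h := Fan.fkg_real (fun _ : Set ι => (1 : ℝ)) f g (fun _ => zero_le_one) hf hg (fun a b => by simp)
  simp only [one_mul, Finset.sum_const, Finset.card_univ, nsmul_eq_mul, mul_one] at h
  have hN : (0 : ℝ) < (Fintype.card (Set ι) : ℝ) := by exact_mod_cast Fintype.card_pos
  rw [div_le_iff₀ hN, mul_comm (∑ T, f T * g T)]
  exact h

section Setting

variable (X₂ Y₂ : Set ι → Set V) (hX : Monotone X₂) (hY : Antitone Y₂) (hXY : ∀ T, Y₂ T = X₂ Tᶜ) (x z : V)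
include hX hY hXY

/-- **THEOREM 2S, abstract core** (HOME/THEOREM-2S.md §1): the mixed two-stage bound
`0 ≤ Σ_{ω₁} ((cR/cB)·[y ∉ X₁ ω₁]·TIrow(ω₁) + [y ∈ X₁ ω₁]·TIIrow(ω₁))` for a graph side `E₁ ∋ sy` and an R-associated abstract side 2 —
no nestedness hypothesis. [this work] -/
theorem mixed_bound (E₁ : Set (Sym2 V)) (s y : V) (hsy : s(s, y) ∈ E₁)
    (hR : ∀ Φ₁ Φ₂ : Set V → Set V → ℝ,
      (∀ ⦃A A' B B' : Set V⦄, A ⊆ A' → B' ⊆ B → Φ₁ A B ≤ Φ₁ A' B') → (∀ ⦃A A' B B' : Set V⦄, A ⊆ A' → B' ⊆ B → Φ₂ A B ≤ Φ₂ A' B') →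
      (∑ T ∈ Finset.univ.filter (fun T : Set ι => z ∉ Y₂ T), Φ₁ (X₂ T) (Y₂ T)) *
          (∑ T ∈ Finset.univ.filter (fun T : Set ι => z ∉ Y₂ T), Φ₂ (X₂ T) (Y₂ T)) ≤
        ((Finset.univ.filter fun T : Set ι => z ∉ Y₂ T).card : ℝ) *
          ∑ T ∈ Finset.univ.filter (fun T : Set ι => z ∉ Y₂ T), Φ₁ (X₂ T) (Y₂ T) * Φ₂ (X₂ T) (Y₂ T))
    (hcR : 0 < (Finset.univ.filter fun T : Set ι => z ∉ Y₂ T).card)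
    {h₁ h₂ : Set V → Set V → ℝ}
    (hh₁ : ∀ ⦃A A' B B' : Set V⦄, A ⊆ A' → B' ⊆ B → h₁ A B ≤ h₁ A' B') (hh₂ : ∀ ⦃A A' B B' : Set V⦄, A ⊆ A' → B' ⊆ B → h₂ A B ≤ h₂ A' B')
    (hodd₁ : ∀ A B, h₁ B A = -h₁ A B) (hodd₂ : ∀ A B, h₂ B A = -h₂ A B) :
    0 ≤ ∑ ω₁ : Set (Sym2 V),
      ((((Finset.univ.filter fun T : Set ι => z ∉ Y₂ T).card : ℝ) / (Fintype.card (Set ι) : ℝ)) *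
          (if y ∉ openCluster (ω₁ ∩ E₁) s then
            ∑ T : Set ι, h₁ (openCluster (ω₁ ∩ E₁) s ∪ X₂ T) (openCluster (ω₁ᶜ ∩ E₁) s ∪ Y₂ T ∪ {v | v ∈ ({x} : Set V) ∧ z ∈ Y₂ T}) *
              h₂ (openCluster (ω₁ ∩ E₁) s ∪ X₂ T) (openCluster (ω₁ᶜ ∩ E₁) s ∪ Y₂ T ∪ {v | v ∈ ({x} : Set V) ∧ z ∈ Y₂ T})
          else 0) +
        (if y ∈ openCluster (ω₁ ∩ E₁) s then
            ∑ T ∈ Finset.univ.filter (fun T : Set ι => z ∉ Y₂ T),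
              h₁ (openCluster (ω₁ ∩ E₁) s ∪ X₂ T ∪ {x}) (openCluster (ω₁ᶜ ∩ E₁) s ∪ Y₂ T) *
                h₂ (openCluster (ω₁ ∩ E₁) s ∪ X₂ T ∪ {x}) (openCluster (ω₁ᶜ ∩ E₁) s ∪ Y₂ T)
          else 0)) := by
  -- constants
  set U : Finset (Set ι) := Finset.univ.filter (fun T : Set ι => z ∉ Y₂ T) with hUdef
  set cR : ℝ := (U.card : ℝ) with hcRdef
  set cB : ℝ := (Fintype.card (Set ι) : ℝ) with hcBdef
  have hcRpos : 0 < cR := by rw [hcRdef]; exact_mod_cast hcR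
  have hcBpos : 0 < cB := by rw [hcBdef]; exact_mod_cast Fintype.card_pos
  have hXc : ∀ T, X₂ Tᶜ = Y₂ T := fun T => (hXY T).symm
  have hYc : ∀ T, Y₂ Tᶜ = X₂ T := fun T => by rw [hXY, compl_compl]
  -- side 1
  let X₁ : Set (Sym2 V) → Set V := fun ω => openCluster (ω ∩ E₁) s
  let Y₁ : Set (Sym2 V) → Set V := fun ω => openCluster (ωᶜ ∩ E₁) s
  have hX₁c : ∀ ω, X₁ ωᶜ = Y₁ ω := fun ω => rfl
  have hY₁c : ∀ ω, Y₁ ωᶜ = X₁ ω := fun ω => by show openCluster (ωᶜᶜ ∩ E₁) s = _; rw [compl_compl]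
  have hyX : ∀ ω, s(s, y) ∈ ω → y ∈ X₁ ω := fun ω hω => Freeze.mem_cluster_of_edge (mem_openCluster_self _ _) ⟨hω, hsy⟩
  have hyY : ∀ ω, s(s, y) ∉ ω → y ∈ Y₁ ω := fun ω hω => Freeze.mem_cluster_of_edge (mem_openCluster_self _ _) ⟨hω, hsy⟩
  -- the four row integrals as functions of a pair
  let Mb : Set V → Set V → ℝ := fun P Q =>
    ∑ T : Set ι, h₁ (P ∪ X₂ T) (Q ∪ Y₂ T ∪ {v | v ∈ ({x} : Set V) ∧ z ∈ Y₂ T}) * h₂ (P ∪ X₂ T) (Q ∪ Y₂ T ∪ {v | v ∈ ({x} : Set V) ∧ z ∈ Y₂ T})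
  let M3 : Set V → Set V → ℝ := fun P Q =>
    ∑ T : Set ι, h₁ (P ∪ X₂ T ∪ {v | v ∈ ({x} : Set V) ∧ z ∈ X₂ T}) (Q ∪ Y₂ T) * h₂ (P ∪ X₂ T ∪ {v | v ∈ ({x} : Set V) ∧ z ∈ X₂ T}) (Q ∪ Y₂ T)
  let M4 : Set V → Set V → ℝ := fun P Q => ∑ T ∈ U, h₁ (P ∪ X₂ T ∪ {x}) (Q ∪ Y₂ T) * h₂ (P ∪ X₂ T ∪ {x}) (Q ∪ Y₂ T)
  let M1 : Set V → Set V → ℝ := fun P Q => ∑ T ∈ U, h₁ (P ∪ Y₂ T) (Q ∪ X₂ T ∪ {x}) * h₂ (P ∪ Y₂ T) (Q ∪ X₂ T ∪ {x})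
  -- the single-function averages (unnormalised): Gb, Gt of …TwoStageInner
  let Gb : (Set V → Set V → ℝ) → Set V → Set V → ℝ := fun h P Q =>
    ∑ T : Set ι, h (P ∪ X₂ T) (Q ∪ Y₂ T ∪ {v | v ∈ ({x} : Set V) ∧ z ∈ Y₂ T})
  let Gt : (Set V → Set V → ℝ) → Set V → Set V → ℝ := fun h P Q => ∑ T ∈ U, h (P ∪ X₂ T ∪ {x}) (Q ∪ Y₂ T)
  -- Step 0a: Mb Q P = M3 P Q (involution `T ↦ Tᶜ` on side 2 + oddness)
  have hsumc : ∀ f : Set ι → ℝ, ∑ T : Set ι, f Tᶜ = ∑ T : Set ι, f T := fun f =>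
    Fintype.sum_equiv (Function.Involutive.toPerm (compl : Set ι → Set ι) compl_involutive) (fun T => f Tᶜ) f (fun _ => rfl)
  have h0a : ∀ P Q, Mb Q P = M3 P Q := by
    intro P Q
    show ∑ T : Set ι, h₁ (Q ∪ X₂ T) (P ∪ Y₂ T ∪ {v | v ∈ ({x} : Set V) ∧ z ∈ Y₂ T}) * h₂ (Q ∪ X₂ T) (P ∪ Y₂ T ∪ {v | v ∈ ({x} : Set V) ∧ z ∈ Y₂ T}) =
      ∑ T : Set ι, h₁ (P ∪ X₂ T ∪ {v | v ∈ ({x} : Set V) ∧ z ∈ X₂ T}) (Q ∪ Y₂ T) * h₂ (P ∪ X₂ T ∪ {v | v ∈ ({x} : Set V) ∧ z ∈ X₂ T}) (Q ∪ Y₂ T)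
    rw [← hsumc (fun T => h₁ (P ∪ X₂ T ∪ {v | v ∈ ({x} : Set V) ∧ z ∈ X₂ T}) (Q ∪ Y₂ T) * h₂ (P ∪ X₂ T ∪ {v | v ∈ ({x} : Set V) ∧ z ∈ X₂ T}) (Q ∪ Y₂ T))]
    refine Finset.sum_congr rfl fun T _ => ?_
    show _ = h₁ (P ∪ X₂ Tᶜ ∪ {v | v ∈ ({x} : Set V) ∧ z ∈ X₂ Tᶜ}) (Q ∪ Y₂ Tᶜ) * h₂ (P ∪ X₂ Tᶜ ∪ {v | v ∈ ({x} : Set V) ∧ z ∈ X₂ Tᶜ}) (Q ∪ Y₂ Tᶜ)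
    rw [hXc, hYc, hodd₁ (P ∪ Y₂ T ∪ _) (Q ∪ X₂ T), hodd₂ (P ∪ Y₂ T ∪ _) (Q ∪ X₂ T)]
    ring
  -- Step 0b: M4 Q P = M1 P Q (oddness)
  have h0b : ∀ P Q, M4 Q P = M1 P Q := by
    intro P Q
    refine Finset.sum_congr rfl fun T _ => ?_
    rw [hodd₁ (P ∪ Y₂ T) (Q ∪ X₂ T ∪ {x}), hodd₂ (P ∪ Y₂ T) (Q ∪ X₂ T ∪ {x})]
    ring
  -- the same for single functions
  have hGb : ∀ (h : Set V → Set V → ℝ), (∀ A B, h B A = -h A B) → ∀ P Q,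
      Gb h Q P = -∑ T : Set ι, h (P ∪ X₂ T ∪ {v | v ∈ ({x} : Set V) ∧ z ∈ X₂ T}) (Q ∪ Y₂ T) := by
    intro h hodd P Q
    show ∑ T : Set ι, h (Q ∪ X₂ T) (P ∪ Y₂ T ∪ {v | v ∈ ({x} : Set V) ∧ z ∈ Y₂ T}) = _
    rw [← hsumc (fun T => h (P ∪ X₂ T ∪ {v | v ∈ ({x} : Set V) ∧ z ∈ X₂ T}) (Q ∪ Y₂ T)), ← Finset.sum_neg_distrib]
    refine Finset.sum_congr rfl fun T _ => ?_
    show _ = -h (P ∪ X₂ Tᶜ ∪ {v | v ∈ ({x} : Set V) ∧ z ∈ X₂ Tᶜ}) (Q ∪ Y₂ Tᶜ)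
    rw [hXc, hYc, hodd (P ∪ Y₂ T ∪ _) (Q ∪ X₂ T)]
  have hGt : ∀ (h : Set V → Set V → ℝ), (∀ A B, h B A = -h A B) → ∀ P Q,
      Gt h Q P = -∑ T ∈ U, h (P ∪ Y₂ T) (Q ∪ X₂ T ∪ {x}) := by
    intro h hodd P Q
    show ∑ T ∈ U, h (Q ∪ X₂ T ∪ {x}) (P ∪ Y₂ T) = _
    rw [← Finset.sum_neg_distrib]
    exact Finset.sum_congr rfl fun T _ => by rw [hodd (P ∪ Y₂ T) (Q ∪ X₂ T ∪ {x})]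
  -- the chain (𝒞), and its consequences `Gb/cB ≤ Gt/cR`, `-Gt Q P ≤ Gt P Q`
  have hC := fun (h : Set V → Set V → ℝ) (hh : ∀ ⦃A A' B B' : Set V⦄, A ⊆ A' → B' ⊆ B → h A B ≤ h A' B')
    (hodd : ∀ A B, h B A = -h A B) (P Q : Set V) => constraint_chain X₂ Y₂ hX hY hXY x z hh hodd P Q
  -- normalised averages a, c, d
  let a : (Set V → Set V → ℝ) → Set V → Set V → ℝ := fun h P Q => Gt h P Q / cR
  let c : (Set V → Set V → ℝ) → Set V → Set V → ℝ := fun h P Q => -Gb h Q P / cB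
  let d : (Set V → Set V → ℝ) → Set V → Set V → ℝ := fun h P Q => -Gt h Q P / cR
  have hca : ∀ (h : Set V → Set V → ℝ), (∀ ⦃A A' B B' : Set V⦄, A ⊆ A' → B' ⊆ B → h A B ≤ h A' B') → (∀ A B, h B A = -h A B) →
      ∀ P Q, c h P Q ≤ a h P Q := by
    intro h hh hodd P Q
    obtain ⟨_, _, c3⟩ := hC h hh hodd P Q
    rw [← hUdef, ← hcBdef, ← hcRdef] at c3
    show -Gb h Q P / cB ≤ Gt h P Q / cR
    rw [div_le_div_iff₀ hcBpos hcRpos]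
    show -(∑ T : Set ι, h (Q ∪ X₂ T) (P ∪ Y₂ T ∪ {v | v ∈ ({x} : Set V) ∧ z ∈ Y₂ T})) * cR ≤ (∑ T ∈ U, h (P ∪ X₂ T ∪ {x}) (Q ∪ Y₂ T)) * cB
    linarith
  have hgbgt : ∀ (h : Set V → Set V → ℝ), (∀ ⦃A A' B B' : Set V⦄, A ⊆ A' → B' ⊆ B → h A B ≤ h A' B') → (∀ A B, h B A = -h A B) →
      ∀ P Q, Gb h P Q / cB ≤ Gt h P Q / cR := by
    intro h hh hodd P Q
    obtain ⟨_, c2, c3⟩ := hC h hh hodd P Q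
    rw [← hUdef, ← hcBdef, ← hcRdef] at c3
    rw [div_le_div_iff₀ hcBpos hcRpos]
    show (∑ T : Set ι, h (P ∪ X₂ T) (Q ∪ Y₂ T ∪ {v | v ∈ ({x} : Set V) ∧ z ∈ Y₂ T})) * cR ≤ (∑ T ∈ U, h (P ∪ X₂ T ∪ {x}) (Q ∪ Y₂ T)) * cB
    have c2' : (∑ T : Set ι, h (P ∪ X₂ T) (Q ∪ Y₂ T ∪ {v | v ∈ ({x} : Set V) ∧ z ∈ Y₂ T})) ≤
        -(∑ T : Set ι, h (Q ∪ X₂ T) (P ∪ Y₂ T ∪ {v | v ∈ ({x} : Set V) ∧ z ∈ Y₂ T})) := by linarith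
    nlinarith [mul_le_mul_of_nonneg_right c2' hcRpos.le]
  have hda : ∀ (h : Set V → Set V → ℝ), (∀ ⦃A A' B B' : Set V⦄, A ⊆ A' → B' ⊆ B → h A B ≤ h A' B') → (∀ A B, h B A = -h A B) →
      ∀ P Q, d h P Q ≤ a h P Q := by
    intro h hh hodd P Q
    obtain ⟨c1, c2, _⟩ := hC h hh hodd P Q
    obtain ⟨_, _, c3⟩ := hC h hh hodd P Q
    rw [← hUdef, ← hcBdef, ← hcRdef] at c1 c3
    show -Gt h Q P / cR ≤ Gt h P Q / cR
    rw [div_le_div_iff_of_pos_right hcRpos]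
    show -(∑ T ∈ U, h (Q ∪ X₂ T ∪ {x}) (P ∪ Y₂ T)) ≤ ∑ T ∈ U, h (P ∪ X₂ T ∪ {x}) (Q ∪ Y₂ T)
    have e1 : -(cB * ∑ T ∈ U, h (Q ∪ X₂ T ∪ {x}) (P ∪ Y₂ T)) ≤ cB * ∑ T ∈ U, h (P ∪ X₂ T ∪ {x}) (Q ∪ Y₂ T) := by
      have : cR * (∑ T : Set ι, h (P ∪ X₂ T) (Q ∪ Y₂ T ∪ {v | v ∈ ({x} : Set V) ∧ z ∈ Y₂ T})) ≤
          -(cR * ∑ T : Set ι, h (Q ∪ X₂ T) (P ∪ Y₂ T ∪ {v | v ∈ ({x} : Set V) ∧ z ∈ Y₂ T})) := by nlinarith [hcRpos.le]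
      linarith
    nlinarith [hcBpos]
  -- Step 1: per-row lower bounds
  have hrowA : ∀ P Q, cR / cB * M3 P Q + M4 P Q ≥ 2 * cR * (((a h₁ P Q + c h₁ P Q) / 2) * ((a h₂ P Q + c h₂ P Q) / 2)) := by
    intro P Q
    -- Harris on the cube for the `m₃` integrands
    have hφ : ∀ (h : Set V → Set V → ℝ), (∀ ⦃A A' B B' : Set V⦄, A ⊆ A' → B' ⊆ B → h A B ≤ h A' B') →
        Monotone (fun T : Set ι => h (P ∪ X₂ T ∪ {v | v ∈ ({x} : Set V) ∧ z ∈ X₂ T}) (Q ∪ Y₂ T)) := by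
      intro h hh T T' hTT'
      exact hh (Set.union_subset_union (Set.union_subset_union_right _ (hX hTT')) (fun v hv => ⟨hv.1, hX hTT' hv.2⟩))
        (Set.union_subset_union_right _ (hY hTT'))
    have hH3 := harris_div (hφ h₁ hh₁) (hφ h₂ hh₂)
    -- R-association for the `m₄` integrands
    have hH4 := hR (fun A B => h₁ (P ∪ A ∪ {x}) (Q ∪ B)) (fun A B => h₂ (P ∪ A ∪ {x}) (Q ∪ B))
      (fun A A' B B' hA hB => hh₁ (Set.union_subset_union_left _ (Set.union_subset_union_right _ hA)) (Set.union_subset_union_right _ hB))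
      (fun A A' B B' hA hB => hh₂ (Set.union_subset_union_left _ (Set.union_subset_union_right _ hA)) (Set.union_subset_union_right _ hB))
    have e3₁ : ∑ T : Set ι, h₁ (P ∪ X₂ T ∪ {v | v ∈ ({x} : Set V) ∧ z ∈ X₂ T}) (Q ∪ Y₂ T) = cB * c h₁ P Q := by
      show _ = cB * (-Gb h₁ Q P / cB); rw [hGb h₁ hodd₁ P Q]; field_simp
    have e3₂ : ∑ T : Set ι, h₂ (P ∪ X₂ T ∪ {v | v ∈ ({x} : Set V) ∧ z ∈ X₂ T}) (Q ∪ Y₂ T) = cB * c h₂ P Q := by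
      show _ = cB * (-Gb h₂ Q P / cB); rw [hGb h₂ hodd₂ P Q]; field_simp
    have e4₁ : ∑ T ∈ U, h₁ (P ∪ X₂ T ∪ {x}) (Q ∪ Y₂ T) = cR * a h₁ P Q := by
      show Gt h₁ P Q = cR * (Gt h₁ P Q / cR); field_simp
    have e4₂ : ∑ T ∈ U, h₂ (P ∪ X₂ T ∪ {x}) (Q ∪ Y₂ T) = cR * a h₂ P Q := by
      show Gt h₂ P Q = cR * (Gt h₂ P Q / cR); field_simp
    rw [e3₁, e3₂, ← hcBdef] at hH3
    rw [e4₁, e4₂] at hH4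
    have hM3 : cB * (c h₁ P Q * c h₂ P Q) ≤ M3 P Q := by
      have : cB * c h₁ P Q * (cB * c h₂ P Q) / cB = cB * (c h₁ P Q * c h₂ P Q) := by field_simp
      rw [this] at hH3; exact hH3
    have hM4 : cR * (a h₁ P Q * a h₂ P Q) ≤ M4 P Q := by
      have : cR * a h₁ P Q * (cR * a h₂ P Q) = cR * (cR * (a h₁ P Q * a h₂ P Q)) := by ring
      rw [this] at hH4
      exact le_of_mul_le_mul_left hH4 hcRpos
    have hmix := mix_two (hca h₁ hh₁ hodd₁ P Q) (hca h₂ hh₂ hodd₂ P Q)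
    have e5 : cR / cB * (cB * (c h₁ P Q * c h₂ P Q)) = cR * (c h₁ P Q * c h₂ P Q) := by field_simp
    have hM3' : cR * (c h₁ P Q * c h₂ P Q) ≤ cR / cB * M3 P Q := by
      rw [← e5]; exact mul_le_mul_of_nonneg_left hM3 (div_nonneg hcRpos.le hcBpos.le)
    nlinarith [mul_le_mul_of_nonneg_left hmix hcRpos.le]
  have hrowM : ∀ P Q, M4 P Q + M1 P Q ≥ 2 * cR * (((a h₁ P Q + d h₁ P Q) / 2) * ((a h₂ P Q + d h₂ P Q) / 2)) := by
    intro P Q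
    have hH4 := hR (fun A B => h₁ (P ∪ A ∪ {x}) (Q ∪ B)) (fun A B => h₂ (P ∪ A ∪ {x}) (Q ∪ B))
      (fun A A' B B' hA hB => hh₁ (Set.union_subset_union_left _ (Set.union_subset_union_right _ hA)) (Set.union_subset_union_right _ hB))
      (fun A A' B B' hA hB => hh₂ (Set.union_subset_union_left _ (Set.union_subset_union_right _ hA)) (Set.union_subset_union_right _ hB))
    have hH1 := hR (fun A B => -h₁ (P ∪ B) (Q ∪ A ∪ {x})) (fun A B => -h₂ (P ∪ B) (Q ∪ A ∪ {x}))
      (fun A A' B B' hA hB => neg_le_neg (hh₁ (Set.union_subset_union_right _ hB) (Set.union_subset_union_left _ (Set.union_subset_union_right _ hA))))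
      (fun A A' B B' hA hB => neg_le_neg (hh₂ (Set.union_subset_union_right _ hB) (Set.union_subset_union_left _ (Set.union_subset_union_right _ hA))))
    have e4₁ : ∑ T ∈ U, h₁ (P ∪ X₂ T ∪ {x}) (Q ∪ Y₂ T) = cR * a h₁ P Q := by
      show Gt h₁ P Q = cR * (Gt h₁ P Q / cR); field_simp
    have e4₂ : ∑ T ∈ U, h₂ (P ∪ X₂ T ∪ {x}) (Q ∪ Y₂ T) = cR * a h₂ P Q := by
      show Gt h₂ P Q = cR * (Gt h₂ P Q / cR); field_simp
    have e1₁ : ∑ T ∈ U, -h₁ (P ∪ Y₂ T) (Q ∪ X₂ T ∪ {x}) = -(cR * d h₁ P Q) := by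
      show _ = -(cR * (-Gt h₁ Q P / cR)); rw [hGt h₁ hodd₁ P Q, Finset.sum_neg_distrib]; field_simp
    have e1₂ : ∑ T ∈ U, -h₂ (P ∪ Y₂ T) (Q ∪ X₂ T ∪ {x}) = -(cR * d h₂ P Q) := by
      show _ = -(cR * (-Gt h₂ Q P / cR)); rw [hGt h₂ hodd₂ P Q, Finset.sum_neg_distrib]; field_simp
    have e1₃ : ∑ T ∈ U, -h₁ (P ∪ Y₂ T) (Q ∪ X₂ T ∪ {x}) * -h₂ (P ∪ Y₂ T) (Q ∪ X₂ T ∪ {x}) = M1 P Q :=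
      Finset.sum_congr rfl fun T _ => by ring
    rw [e4₁, e4₂] at hH4
    rw [e1₁, e1₂, e1₃] at hH1
    have hM4 : cR * (a h₁ P Q * a h₂ P Q) ≤ M4 P Q := by
      have : cR * a h₁ P Q * (cR * a h₂ P Q) = cR * (cR * (a h₁ P Q * a h₂ P Q)) := by ring
      rw [this] at hH4
      exact le_of_mul_le_mul_left hH4 hcRpos
    have hM1 : cR * (d h₁ P Q * d h₂ P Q) ≤ M1 P Q := by
      have : -(cR * d h₁ P Q) * -(cR * d h₂ P Q) = cR * (cR * (d h₁ P Q * d h₂ P Q)) := by ring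
      rw [this] at hH1
      exact le_of_mul_le_mul_left hH1 hcRpos
    have hmix := mix_two (hda h₁ hh₁ hodd₁ P Q) (hda h₂ hh₂ hodd₂ P Q)
    nlinarith [mul_le_mul_of_nonneg_left hmix hcRpos.le]
  -- Step 2: the piecewise function 𝒦 is twisted-monotone and super-odd; Harris on the red-pinned cube
  let K : (Set V → Set V → ℝ) → Set V → Set V → ℝ := fun h P Q =>
    if y ∉ Q then (a h P Q + c h P Q) / 2 else (a h P Q + d h P Q) / 2
  have hamono : ∀ (h : Set V → Set V → ℝ), (∀ ⦃A A' B B' : Set V⦄, A ⊆ A' → B' ⊆ B → h A B ≤ h A' B') →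
      ∀ ⦃A A' B B' : Set V⦄, A ⊆ A' → B' ⊆ B → a h A B ≤ a h A' B' := by
    intro h hh A A' B B' hA hB
    show Gt h A B / cR ≤ Gt h A' B' / cR
    exact div_le_div_of_nonneg_right (by have := Gt_mono X₂ Y₂ x z hh hA hB; rw [← hUdef] at this; exact this) hcRpos.le
  have hcmono : ∀ (h : Set V → Set V → ℝ), (∀ ⦃A A' B B' : Set V⦄, A ⊆ A' → B' ⊆ B → h A B ≤ h A' B') →
      ∀ ⦃A A' B B' : Set V⦄, A ⊆ A' → B' ⊆ B → c h A B ≤ c h A' B' := by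
    intro h hh A A' B B' hA hB
    show -Gb h B A / cB ≤ -Gb h B' A' / cB
    exact div_le_div_of_nonneg_right (neg_le_neg (Gb_mono X₂ Y₂ x z hh hB hA)) hcBpos.le
  have hdmono : ∀ (h : Set V → Set V → ℝ), (∀ ⦃A A' B B' : Set V⦄, A ⊆ A' → B' ⊆ B → h A B ≤ h A' B') →
      ∀ ⦃A A' B B' : Set V⦄, A ⊆ A' → B' ⊆ B → d h A B ≤ d h A' B' := by
    intro h hh A A' B B' hA hB
    show -Gt h B A / cR ≤ -Gt h B' A' / cR
    exact div_le_div_of_nonneg_right (neg_le_neg (by have := Gt_mono X₂ Y₂ x z hh hB hA; rw [← hUdef] at this; exact this)) hcRpos.le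
  -- `d ≤ c` across the boundary: -Gt h B A / cR ≤ -Gb h B' A' / cB when (B', A') ≼ (B, A)
  have hdc : ∀ (h : Set V → Set V → ℝ), (∀ ⦃A A' B B' : Set V⦄, A ⊆ A' → B' ⊆ B → h A B ≤ h A' B') → (∀ A B, h B A = -h A B) →
      ∀ ⦃A A' B B' : Set V⦄, A ⊆ A' → B' ⊆ B → d h A B ≤ c h A' B' := by
    intro h hh hodd A A' B B' hA hB
    show -Gt h B A / cR ≤ -Gb h B' A' / cB
    have h1 : Gb h B' A' / cB ≤ Gb h B A / cB := div_le_div_of_nonneg_right (Gb_mono X₂ Y₂ x z hh hB hA) hcBpos.le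
    have h2 : Gb h B A / cB ≤ Gt h B A / cR := hgbgt h hh hodd B A
    rw [neg_div, neg_div]
    linarith
  have hKmono : ∀ (h : Set V → Set V → ℝ), (∀ ⦃A A' B B' : Set V⦄, A ⊆ A' → B' ⊆ B → h A B ≤ h A' B') → (∀ A B, h B A = -h A B) →
      ∀ ⦃A A' B B' : Set V⦄, A ⊆ A' → B' ⊆ B → K h A B ≤ K h A' B' := by
    intro h hh hodd A A' B B' hA hB
    show (if y ∉ B then (a h A B + c h A B) / 2 else (a h A B + d h A B) / 2) ≤
      (if y ∉ B' then (a h A' B' + c h A' B') / 2 else (a h A' B' + d h A' B') / 2)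
    have ha := hamono h hh hA hB
    by_cases hyB : y ∈ B
    · by_cases hyB' : y ∈ B'
      · rw [if_neg (not_not.2 hyB), if_neg (not_not.2 hyB')]
        have := hdmono h hh hA hB; linarith
      · rw [if_neg (not_not.2 hyB), if_pos hyB']
        have := hdc h hh hodd hA hB; linarith
    · have hyB' : y ∉ B' := fun h' => hyB (hB h')
      rw [if_pos hyB, if_pos hyB']
      have := hcmono h hh hA hB; linarith
  have hKso : ∀ (h : Set V → Set V → ℝ), (∀ ⦃A A' B B' : Set V⦄, A ⊆ A' → B' ⊆ B → h A B ≤ h A' B') → (∀ A B, h B A = -h A B) →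
      ∀ A B, 0 ≤ K h A B + K h B A := by
    intro h hh hodd A B
    show 0 ≤ (if y ∉ B then (a h A B + c h A B) / 2 else (a h A B + d h A B) / 2) +
      (if y ∉ A then (a h B A + c h B A) / 2 else (a h B A + d h B A) / 2)
    have g1 : 0 ≤ a h A B + c h B A := by
      show 0 ≤ Gt h A B / cR + -Gb h A B / cB
      have := hgbgt h hh hodd A B; rw [neg_div]; linarith
    have g2 : 0 ≤ a h B A + c h A B := by
      show 0 ≤ Gt h B A / cR + -Gb h B A / cB
      have := hgbgt h hh hodd B A; rw [neg_div]; linarith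
    have g3 : a h A B + d h B A = 0 := by
      show Gt h A B / cR + -Gt h A B / cR = 0; ring
    have g4 : a h B A + d h A B = 0 := by
      show Gt h B A / cR + -Gt h B A / cR = 0; ring
    by_cases hyB : y ∈ B <;> by_cases hyA : y ∈ A
    · rw [if_neg (not_not.2 hyB), if_neg (not_not.2 hyA)]; linarith
    · rw [if_neg (not_not.2 hyB), if_pos hyA]; linarith
    · rw [if_pos hyB, if_neg (not_not.2 hyA)]; linarith
    · rw [if_pos hyB, if_pos hyA]; linarith
  have hcube := pinned_cube_sum_nonneg E₁ s s(s, y) (hKmono h₁ hh₁ hodd₁) (hKso h₁ hh₁ hodd₁) (hKmono h₂ hh₂ hodd₂) (hKso h₂ hh₂ hodd₂)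
  -- Step 0c: rewrite the target over the red-pinned cube
  have hre : ∑ ω₁ : Set (Sym2 V), (cR / cB * (if y ∉ X₁ ω₁ then Mb (X₁ ω₁) (Y₁ ω₁) else 0) + (if y ∈ X₁ ω₁ then M4 (X₁ ω₁) (Y₁ ω₁) else 0)) =
      ∑ ω₁ ∈ Finset.univ.filter (fun ω₁ : Set (Sym2 V) => s(s, y) ∈ ω₁),
        (if y ∉ Y₁ ω₁ then cR / cB * M3 (X₁ ω₁) (Y₁ ω₁) + M4 (X₁ ω₁) (Y₁ ω₁) else M4 (X₁ ω₁) (Y₁ ω₁) + M1 (X₁ ω₁) (Y₁ ω₁)) := by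
    have hinv : ∀ f : Set (Sym2 V) → ℝ, ∑ ω : Set (Sym2 V), f ωᶜ = ∑ ω : Set (Sym2 V), f ω := fun f =>
      Fintype.sum_equiv (Function.Involutive.toPerm (compl : Set (Sym2 V) → Set (Sym2 V)) compl_involutive) (fun ω => f ωᶜ) f (fun _ => rfl)
    -- TERM I rows: `y ∉ X₁ ω₁` ↔ `y ∉ Y₁ ω₁ᶜ`
    have h1 : ∑ ω₁ : Set (Sym2 V), (if y ∉ X₁ ω₁ then Mb (X₁ ω₁) (Y₁ ω₁) else 0) =
        ∑ ω₁ : Set (Sym2 V), (if y ∉ Y₁ ω₁ then M3 (X₁ ω₁) (Y₁ ω₁) else 0) := by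
      rw [← hinv (fun ω₁ => if y ∉ Y₁ ω₁ then M3 (X₁ ω₁) (Y₁ ω₁) else 0)]
      refine Finset.sum_congr rfl fun ω₁ _ => ?_
      show (if y ∉ X₁ ω₁ then Mb (X₁ ω₁) (Y₁ ω₁) else 0) = (if y ∉ Y₁ ω₁ᶜ then M3 (X₁ ω₁ᶜ) (Y₁ ω₁ᶜ) else 0)
      rw [hY₁c, hX₁c, ← h0a]
    -- TERM II rows with `sy` blue ↔ rows with `sy` red and `y ∈ Y₁`
    have h2 : ∑ ω₁ : Set (Sym2 V), (if y ∈ X₁ ω₁ then M4 (X₁ ω₁) (Y₁ ω₁) else 0) =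
        ∑ ω₁ : Set (Sym2 V), ((if s(s, y) ∈ ω₁ then M4 (X₁ ω₁) (Y₁ ω₁) else 0) +
          (if s(s, y) ∉ ω₁ ∧ y ∈ X₁ ω₁ then M4 (X₁ ω₁) (Y₁ ω₁) else 0)) := by
      refine Finset.sum_congr rfl fun ω₁ _ => ?_
      by_cases hω : s(s, y) ∈ ω₁
      · rw [if_pos (hyX ω₁ hω), if_pos hω, if_neg (fun h => h.1 hω), add_zero]
      · by_cases hyx : y ∈ X₁ ω₁
        · rw [if_pos hyx, if_neg hω, if_pos ⟨hω, hyx⟩, zero_add]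
        · rw [if_neg hyx, if_neg hω, if_neg (fun h => hyx h.2), add_zero]
    have h3 : ∑ ω₁ : Set (Sym2 V), (if s(s, y) ∉ ω₁ ∧ y ∈ X₁ ω₁ then M4 (X₁ ω₁) (Y₁ ω₁) else 0) =
        ∑ ω₁ : Set (Sym2 V), (if s(s, y) ∈ ω₁ ∧ y ∈ Y₁ ω₁ then M1 (X₁ ω₁) (Y₁ ω₁) else 0) := by
      rw [← hinv (fun ω₁ => if s(s, y) ∈ ω₁ ∧ y ∈ Y₁ ω₁ then M1 (X₁ ω₁) (Y₁ ω₁) else 0)]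
      refine Finset.sum_congr rfl fun ω₁ _ => ?_
      by_cases hc : s(s, y) ∉ ω₁ ∧ y ∈ X₁ ω₁
      · have hc' : s(s, y) ∈ ω₁ᶜ ∧ y ∈ Y₁ ω₁ᶜ := by rw [hY₁c]; exact hc
        rw [if_pos hc, if_pos hc', hY₁c, hX₁c, h0b]
      · have hc' : ¬ (s(s, y) ∈ ω₁ᶜ ∧ y ∈ Y₁ ω₁ᶜ) := by rw [hY₁c]; exact hc
        rw [if_neg hc, if_neg hc']
    have eL : ∑ ω₁ : Set (Sym2 V), (cR / cB * (if y ∉ X₁ ω₁ then Mb (X₁ ω₁) (Y₁ ω₁) else 0) + (if y ∈ X₁ ω₁ then M4 (X₁ ω₁) (Y₁ ω₁) else 0)) =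
        cR / cB * ∑ ω₁ : Set (Sym2 V), (if y ∉ Y₁ ω₁ then M3 (X₁ ω₁) (Y₁ ω₁) else 0) +
          (∑ ω₁ : Set (Sym2 V), (if s(s, y) ∈ ω₁ then M4 (X₁ ω₁) (Y₁ ω₁) else 0) +
            ∑ ω₁ : Set (Sym2 V), (if s(s, y) ∈ ω₁ ∧ y ∈ Y₁ ω₁ then M1 (X₁ ω₁) (Y₁ ω₁) else 0)) := by
      rw [Finset.sum_add_distrib, ← Finset.mul_sum, h1, h2, Finset.sum_add_distrib, h3]
    rw [eL, Finset.sum_filter, Finset.mul_sum, ← Finset.sum_add_distrib, ← Finset.sum_add_distrib]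
    refine Finset.sum_congr rfl fun ω₁ _ => ?_
    by_cases hω : s(s, y) ∈ ω₁
    · rw [if_pos hω, if_pos hω]
      by_cases hyY : y ∈ Y₁ ω₁
      · rw [if_neg (not_not.2 hyY), if_pos ⟨hω, hyY⟩, if_neg (not_not.2 hyY)]; ring
      · rw [if_pos hyY, if_neg (fun h => hyY h.2), if_pos hyY]; ring
    · have hyY : y ∈ Y₁ ω₁ := hyY ω₁ hω
      rw [if_neg (not_not.2 hyY), if_neg hω, if_neg (fun h => hω h.1), if_neg hω]; ring
  -- Step 3: assemble
  have hmain : 0 ≤ ∑ ω₁ ∈ Finset.univ.filter (fun ω₁ : Set (Sym2 V) => s(s, y) ∈ ω₁),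
      (if y ∉ Y₁ ω₁ then cR / cB * M3 (X₁ ω₁) (Y₁ ω₁) + M4 (X₁ ω₁) (Y₁ ω₁) else M4 (X₁ ω₁) (Y₁ ω₁) + M1 (X₁ ω₁) (Y₁ ω₁)) := by
    have hle : ∑ ω₁ ∈ Finset.univ.filter (fun ω₁ : Set (Sym2 V) => s(s, y) ∈ ω₁), 2 * cR * (K h₁ (X₁ ω₁) (Y₁ ω₁) * K h₂ (X₁ ω₁) (Y₁ ω₁)) ≤
        ∑ ω₁ ∈ Finset.univ.filter (fun ω₁ : Set (Sym2 V) => s(s, y) ∈ ω₁),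
          (if y ∉ Y₁ ω₁ then cR / cB * M3 (X₁ ω₁) (Y₁ ω₁) + M4 (X₁ ω₁) (Y₁ ω₁) else M4 (X₁ ω₁) (Y₁ ω₁) + M1 (X₁ ω₁) (Y₁ ω₁)) := by
      refine Finset.sum_le_sum fun ω₁ _ => ?_
      show 2 * cR * ((if y ∉ Y₁ ω₁ then (a h₁ (X₁ ω₁) (Y₁ ω₁) + c h₁ (X₁ ω₁) (Y₁ ω₁)) / 2 else (a h₁ (X₁ ω₁) (Y₁ ω₁) + d h₁ (X₁ ω₁) (Y₁ ω₁)) / 2) *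
          (if y ∉ Y₁ ω₁ then (a h₂ (X₁ ω₁) (Y₁ ω₁) + c h₂ (X₁ ω₁) (Y₁ ω₁)) / 2 else (a h₂ (X₁ ω₁) (Y₁ ω₁) + d h₂ (X₁ ω₁) (Y₁ ω₁)) / 2)) ≤ _
      by_cases hyY : y ∈ Y₁ ω₁
      · rw [if_neg (not_not.2 hyY), if_neg (not_not.2 hyY), if_neg (not_not.2 hyY)]
        exact hrowM (X₁ ω₁) (Y₁ ω₁)
      · rw [if_pos hyY, if_pos hyY, if_pos hyY]
        exact hrowA (X₁ ω₁) (Y₁ ω₁)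
    refine le_trans ?_ hle
    rw [← Finset.mul_sum]
    exact mul_nonneg (mul_nonneg zero_le_two hcRpos.le) hcube
  show 0 ≤ ∑ ω₁ : Set (Sym2 V), (cR / cB * (if y ∉ X₁ ω₁ then Mb (X₁ ω₁) (Y₁ ω₁) else 0) + (if y ∈ X₁ ω₁ then M4 (X₁ ω₁) (Y₁ ω₁) else 0))
  rw [hre]
  exact hmain

end Setting

end TwoStage

end Antithetic

end Summit.CriticalPhenomena.PercolationContinuityZ3.Theorems
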